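import Mathlib.Algebra.Ring.BooleanRing
import Mathlib.Algebra.BigOperators.Fin
import Mathlib.Algebra.Group.Pi.Lemmas
import Mathlib.Analysis.Complex.Basic
import Mathlib.Analysis.SpecialFunctions.Pow.Real
import Mathlib.LinearAlgebra.CliffordAlgebra.Basic
import Mathlib.LinearAlgebra.CliffordAlgebra.Contraction
import Mathlib.LinearAlgebra.ExteriorAlgebra.Basis
import Mathlib.LinearAlgebra.FiniteDimensional.Lemmas
import Mathlib.Data.Fintype.Powerset
import HarnessLib

/-!
# Clifford multiplication as a cocycle-twisted convolution over `(ℤ/2)ⁿ`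

**Sources.** H. Albuquerque, S. Majid, *Clifford algebras obtained by twisting of group algebras*,
J. Pure Appl. Algebra 171 (2002) 133–148 [AlbuquerqueMajid2002], §2 (Prop. 2.1: the cochain
`F(x,y) = (−1)^{Σ_{j<i} x_i y_j} ∏ᵢ qᵢ^{xᵢyᵢ}` on `G = (ℤ/2)ⁿ` is a 2-cocycle; Prop. 2.2: the twisted
group algebra `k_F[(ℤ/2)ⁿ]`, `e_x · e_y = F(x,y) e_{x+y}`, `e_x = e₁^{x₁}⋯eₙ^{xₙ}`, is the Clifford algebra
`C(V, q)` of the diagonal form `q(eᵢ) = qᵢ`: `eᵢ·eⱼ = −eⱼ·eᵢ (i ≠ j)`, `eᵢ·eᵢ = qᵢ`); and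
K. A. Muchane, *Quantum algorithm for Clifford multiplication*, arXiv:2607.10473v1 (2026)
[Muchane2026], §2 (binary blade encoding, `e_x e_y = χ_{p,q}(x,y) e_{x⊕y}` with the Boolean phase
polynomial `Φ_{p,q}(x,y) = Σ_{i<j} x_j y_i + Σ_{i>p} x_i y_i`, Table 1, the coefficient map
`c_z = Σ_{x⊕y=z} a_x b_y χ(x,y) = Σ_x a_x b_{x⊕z} χ(x, x⊕z)` = "cocycle-twisted convolution") and
Theorem 2.5 (the circuit `U_χ`, `U_⊕`, `H^{⊗n}` whose trivial-character branch carries `2^{-n/2} c_z`,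
success probability `p₀ = 2^{-n} Σ_z |c_z|²`).

**What is here (all proved, no named facts).**
* `Blade n = Fin n → Bool` with the XOR group law (Mathlib's Boolean ring on `Bool`); `gen i = δ_i`.
* `exchSign`, `metricFactor`, `twist q` = Albuquerque–Majid's `F` for arbitrary weights `q : Fin n → K`
  over any commutative ring; `sigWeight K p` / `chi K p` = Muchane's `χ_{p,q}`;
  `chi_eq_neg_one_pow` : `χ_{p,q} = (−1)^{Φ_{p,q}}` with `Φ` the printed pair/coincidence counts
  (`exchCount`, `metCount`); `twist_cocycle` : **`F(x,y)F(x⊕y,z) = F(y,z)F(x,y⊕z)`** (Prop. 2.1);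
  the generator values `twist_gen_gen_of_lt/gt`, `twist_gen_self`, `twist_gen_gen_antisymm`.
* Multivectors as coefficient functions `MV n K`; the printed product `gp` (sum over `x ⊕ y = z`) and
  the twisted convolution `twConv`; `gp_eq_twConv` (Muchane's regrouping), `gp_bladeVec_bladeVec` :
  **`e_x e_y = F(x,y) e_{x⊕y}`**, two-sided unit `e_∅`, `twConv_assoc` / `gp_assoc` (associativity from
  the cocycle identity), and the Clifford relations `gp_gen_gen_add_gp_gen_gen` (`eₐe_b + e_be_a = 0`),
  `gp_gen_gen_self` (`eₐ² = qₐ·1`).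
* Theorem 2.5 as a state identity over `ℂ`: `circuitState_zero` (amplitude of `|0ⁿ⟩|z⟩` is
  `2^{-n/2} c_z`), `circuitState_zero_norm_sq` (`p₀ = 2^{-n} Σ|c_z|²`), norm preservation of `U_χ`
  (`±1` weights), `U_⊕` and `H^{⊗n} ⊗ 1` (Walsh orthogonality `sum_walsh`, Parseval
  `sum_norm_sq_walsh_transform`), `norm_sq_circuitState`, `successProbability`.
* Muchane's Table 1 (`Cℓ_{3,0}`) row by row, by `decide`.

* (appended 2026-08-20, same seat) bilinearity of the twisted product, the Clifford relation for
  vectors `gp_vec_vec` : `v · v = (Σ qᵢvᵢ²) e_∅`, and Albuquerque–Majid Prop. 2.2 as a UNIVERSAL MAP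
  from Mathlib's `CliffordAlgebra (QuadraticMap.weightedSumSquares K q)`: the left-regular action
  `cliffordRep` (via `CliffordAlgebra.lift`), the identification `toTwisted : C(V,q) →ₗ K_F[(ℤ/2)ⁿ]`,
  `c ↦ ρ(c) e_∅`, with `toTwisted_ι_single` (`eᵢ ↦ eᵢ`), `toTwisted_one`, `toTwisted_mul`
  (multiplicative for the twisted product), `cliffordRep_eq_leftMul`, and `toTwisted_surjective`;
  over a FIELD with `2` invertible (the source's standing hypothesis "characteristic not 2"):
  `finrank_cliffordAlgebra` (`dim C(V,q) = 2ⁿ`, via Mathlib's `CliffordAlgebra.equivExterior` and the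
  `Finset`-indexed basis of the exterior algebra), `toTwisted_bijective`, the linear equivalence
  `toTwistedEquiv : C(V,q) ≃ₗ L_F[(ℤ/2)ⁿ]` and `toTwistedEquiv_symm_mul` — Albuquerque–Majid
  Prop. 2.2 in full: the Clifford product IS the cocycle-twisted convolution.

**What is NOT here.** Injectivity of `toTwisted` over general commutative rings / in
characteristic `2` (only surjectivity is proved there); the gate/depth counts of Theorem 2.5 and the oracle synthesis
(Muchane Lemmas 2.1–2.3, Prop. 2.4); anything about classical or quantum COMPLEXITY of Clifford
multiplication. No statement of this file is specific to the (unrefereed) quantum-advantage claim of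
[Muchane2026]; the algebra is Albuquerque–Majid's, the circuit identity is finite linear algebra.
-- TODO(general form): injectivity of `toTwisted` over an arbitrary commutative ring `K` (free of rank `2ⁿ` on both sides).

Consumers in this project: the `pub-qadeq` adjudication of CLAIMS row A-118 / §1 OPEN-32
(classical sample-and-query comparator for the amplitude-encoded product `|AB⟩`; its two
implementations compute exactly `twConv` and the `p₀` of `circuitState_zero_norm_sq`).

## References

* H. Albuquerque, S. Majid, *Clifford algebras obtained by twisting of group algebras*, J. Pure
  Appl. Algebra 171 (2–3) (2002) 133–148, doi:10.1016/s0022-4049(01)00124-4, arXiv:math/0011040,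
  §2, Props. 2.1–2.2. [AlbuquerqueMajid2002]
* K. A. Muchane, *Quantum algorithm for Clifford multiplication*, arXiv:2607.10473v1 [quant-ph]
  (11 Jul 2026), §2 pp. 4–8, Table 1, Theorem 2.5 pp. 13–14. [Muchane2026]
* R. O'Donnell, *Analysis of Boolean Functions*, CUP 2014, §1.3 Thm. 1.5, Facts 1.6–1.7, §1.4
  Parseval's Theorem (orthogonality of the parity characters of `(ℤ/2)ⁿ`). [ODonnell2014]
* P. Lounesto, *Clifford Algebras and Spinors*, 2nd ed., CUP 2001, Ch. 21 (binary index sets,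
  Walsh functions) — background for the `(ℤ/2)ⁿ` labelling; not cited by any declaration.
-/

noncomputable section

open Finset

namespace Literature.Computability.QuantumAlgorithms.CliffordTwistedConvolution

variable {n : ℕ} {K : Type*} [CommRing K]

/-! ### Blade indices: the group `(ℤ/2)ⁿ` as `Fin n → Bool` -/

/-- **Blade index.** A basis blade `e_x = e₁^{x₁} ⋯ eₙ^{xₙ}` of an `n`-generator Clifford algebra
is encoded by its characteristic bit vector `x ∈ (ℤ/2)ⁿ`, here `Fin n → Bool` (index `i : Fin n`
stands for the generator `e_{i+1}`); the group law of `(ℤ/2)ⁿ` is the pointwise `xor`, which is the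
`+` of Mathlib's Boolean-ring structure on `Bool`.
[cite: Muchane2026, §2 'Basis encoding', p. 4; AlbuquerqueMajid2002, §2 eq. (5) `e_x = e₁^{x₁}⋯eₙ^{xₙ}`] -/
abbrev Blade (n : ℕ) : Type := Fin n → Bool

/-- The group law on blade indices is bitwise XOR. [cite: Muchane2026, §2, p. 5 (`x ⊕ y`)] -/
theorem add_apply_eq_xor (x y : Blade n) (i : Fin n) : (x + y) i = xor (x i) (y i) := rfl

/-- In Mathlib's Boolean ring structure on `Bool`, `0 = false`. [folklore] -/
@[simp] private theorem bool_zero_eq_false : (0 : Bool) = false := rfl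

/-- Every blade index is an involution: `x ⊕ x = 0`. [folklore] -/
private theorem blade_add_self (x : Blade n) : x + x = 0 := by
  funext i; exact BooleanRing.add_self (x i)

/-- `x ⊕ (x ⊕ z) = z`. [folklore] -/
private theorem add_add_cancel_left (x z : Blade n) : x + (x + z) = z := by
  rw [← add_assoc, blade_add_self, zero_add]

/-- `(x ⊕ u) ⊕ (x ⊕ z) = u ⊕ z`. [folklore] -/
private theorem add_add_add_cancel (x u z : Blade n) : (x + u) + (x + z) = u + z := by
  rw [add_add_add_comm, blade_add_self, zero_add]

/-- In `(ℤ/2)ⁿ`, `x ⊕ y = z ↔ y = x ⊕ z`. [folklore] -/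
private theorem add_eq_iff_eq_add (x y z : Blade n) : x + y = z ↔ y = x + z := by
  constructor
  · rintro rfl; rw [add_add_cancel_left]
  · rintro rfl; rw [add_add_cancel_left]

/-- The index of the generator `e_{i+1}`: the bit vector `δ_i`. [cite: AlbuquerqueMajid2002, §2 (proof of Prop. 2.2: "x_i = 1 = y_j and other entries are zero")] -/
def gen (i : Fin n) : Blade n := Pi.single i true

/-- `δ_i(i) = 1`. [folklore] -/
@[simp] private theorem gen_apply_self (i : Fin n) : gen i i = true := by simp [gen]

/-- `δ_i(j) = 0` for `j ≠ i`. [folklore] -/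
private theorem gen_apply_of_ne {i j : Fin n} (h : j ≠ i) : gen i j = false := by
  simp [gen, h]

/-! ### The sign of a bit and the Clifford cocycle -/

/-- The sign `(−1)^b` of a bit `b`, in the coefficient ring `K`. [folklore] -/
def bsign (K : Type*) [CommRing K] (b : Bool) : K := if b then -1 else 1

/-- `(−1)^1 = −1`. [folklore] -/
@[simp] private theorem bsign_true : bsign K true = -1 := rfl
/-- `(−1)^0 = 1`. [folklore] -/
@[simp] private theorem bsign_false : bsign K false = 1 := rfl

/-- `((−1)^b)² = 1`. [folklore] -/
private theorem bsign_mul_self (b : Bool) : bsign K b * bsign K b = 1 := by cases b <;> simp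

/-- `(−1)^{(a⊕b)c} = (−1)^{ac} (−1)^{bc}`. [folklore] -/
private theorem bsign_xor_and (a b c : Bool) :
    bsign K (xor a b && c) = bsign K (a && c) * bsign K (b && c) := by
  cases a <;> cases b <;> cases c <;> simp

/-- `(−1)^{a(b⊕c)} = (−1)^{ab} (−1)^{ac}`. [folklore] -/
private theorem bsign_and_xor (a b c : Bool) :
    bsign K (a && xor b c) = bsign K (a && b) * bsign K (a && c) := by
  cases a <;> cases b <;> cases c <;> simp

/-- **Exchange sign** `χ_ex(x,y) = (−1)^{Σ_{i<j} x_j y_i}`: the parity of the transpositions needed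
to bring `e_x e_y` into canonical order (a generator `e_j` of the left factor crosses a generator
`e_i` of the right factor whenever `i < j`). Written as a product of `±1` factors over the pairs
`(j, i)` with `i < j`. [cite: Muchane2026, §2.1 'The cocycle oracle', p. 8 (`Φ_ex`, `χ_ex`); AlbuquerqueMajid2002, Prop. 2.1 (the factor `(−1)^{Σ_{j<i} x_i y_j}`)] -/
def exchSign (K : Type*) [CommRing K] (x y : Blade n) : K :=
  ∏ j : Fin n, ∏ i : Fin n, if i < j then bsign K (x j && y i) else 1

/-- **Metric factor** `∏ᵢ qᵢ^{xᵢ yᵢ}`: one factor `qᵢ = eᵢ²` for every generator present in both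
blades (Albuquerque–Majid allow arbitrary non-zero `qᵢ`; for `Cℓ_{p,q}` one takes `qᵢ = +1` for the
first `p` generators and `−1` for the last `q`, which is Muchane's `χ_met = (−1)^{Σ_{i>p} xᵢyᵢ}`).
[cite: AlbuquerqueMajid2002, Prop. 2.1 (the factor `∏ qᵢ^{xᵢyᵢ}`); Muchane2026, p. 8 (`Φ_met`, `χ_met`)] -/
def metricFactor (q : Fin n → K) (x y : Blade n) : K :=
  ∏ i : Fin n, if (x i && y i) = true then q i else 1

/-- **The Clifford cocycle / twisting cochain** `F(x,y) = (−1)^{Σ_{i<j} x_j y_i} ∏ᵢ qᵢ^{xᵢyᵢ}` on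
`(ℤ/2)ⁿ` with weights `q : Fin n → K`; for the signature weights `sigWeight K p` this is Muchane's
`χ_{p,q}(x,y) = (−1)^{Φ_{p,q}(x,y)}` (see `chi`, `chi_eq_neg_one_pow`).
[cite: AlbuquerqueMajid2002, Prop. 2.1; Muchane2026, §2 p. 5 (`e_x e_y = χ_{p,q}(x,y) e_{x⊕y}`) and p. 8] -/
def twist (q : Fin n → K) (x y : Blade n) : K := exchSign K x y * metricFactor q x y

/-- The signature weights of `Cℓ_{p,q}`: `qᵢ = eᵢ² = +1` for the first `p` generators (0-based
indices `i < p`) and `−1` for the remaining `q = n − p`. [cite: Muchane2026, p. 8 ("the metric contribution from repeated generators in the negative directions, where e_i² = −1", indices `i = p+1, …, n`)] -/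
def sigWeight (K : Type*) [CommRing K] (p : ℕ) : Fin n → K := fun i => if (i : ℕ) < p then 1 else -1

/-- **Muchane's Clifford cocycle** `χ_{p,q}` of `Cℓ_{p,q}` (`n = p + q` generators).
[cite: Muchane2026, §2 p. 5 and §2.1 p. 7–8] -/
def chi (K : Type*) [CommRing K] (p : ℕ) (x y : Blade n) : K := twist (sigWeight K p) x y

/-- `χ_ex(0, y) = 1`. [folklore] -/
@[simp] private theorem exchSign_zero_left (y : Blade n) : exchSign K 0 y = 1 := by
  simp [exchSign]

/-- `χ_ex(x, 0) = 1`. [folklore] -/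
@[simp] private theorem exchSign_zero_right (x : Blade n) : exchSign K x 0 = 1 := by
  simp [exchSign]

/-- `χ_met(0, y) = 1`. [folklore] -/
@[simp] private theorem metricFactor_zero_left (q : Fin n → K) (y : Blade n) : metricFactor q 0 y = 1 := by
  simp [metricFactor]

/-- `χ_met(x, 0) = 1`. [folklore] -/
@[simp] private theorem metricFactor_zero_right (q : Fin n → K) (x : Blade n) : metricFactor q x 0 = 1 := by
  simp [metricFactor]

/-- The cochain is normalised: `F(0, y) = 1` (`e_∅` is a left unit). [cite: AlbuquerqueMajid2002, §2 ("F(e,x) = F(x,e) = 1")] -/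
@[simp] theorem twist_zero_left (q : Fin n → K) (y : Blade n) : twist q 0 y = 1 := by
  simp [twist]

/-- The cochain is normalised: `F(x, 0) = 1` (`e_∅` is a right unit). [cite: AlbuquerqueMajid2002, §2 ("F(e,x) = F(x,e) = 1")] -/
@[simp] theorem twist_zero_right (q : Fin n → K) (x : Blade n) : twist q x 0 = 1 := by
  simp [twist]

/-- The exchange sign is a bicharacter, left argument: `χ_ex(x⊕y, z) = χ_ex(x,z) χ_ex(y,z)` ("the
`(−1)` factors certainly do not contribute by linearity"). [cite: AlbuquerqueMajid2002, proof of Prop. 2.1] -/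
theorem exchSign_add_left (x y z : Blade n) :
    exchSign K (x + y) z = exchSign K x z * exchSign K y z := by
  unfold exchSign
  rw [← Finset.prod_mul_distrib]
  refine Finset.prod_congr rfl fun j _ => ?_
  rw [← Finset.prod_mul_distrib]
  refine Finset.prod_congr rfl fun i _ => ?_
  split_ifs with h
  · rw [add_apply_eq_xor, bsign_xor_and]
  · rw [one_mul]

/-- The exchange sign is a bicharacter, right argument: `χ_ex(x, y⊕z) = χ_ex(x,y) χ_ex(x,z)`.
[cite: AlbuquerqueMajid2002, proof of Prop. 2.1] -/
theorem exchSign_add_right (x y z : Blade n) :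
    exchSign K x (y + z) = exchSign K x y * exchSign K x z := by
  unfold exchSign
  rw [← Finset.prod_mul_distrib]
  refine Finset.prod_congr rfl fun j _ => ?_
  rw [← Finset.prod_mul_distrib]
  refine Finset.prod_congr rfl fun i _ => ?_
  split_ifs with h
  · rw [add_apply_eq_xor, bsign_and_xor]
  · rw [one_mul]

/-- `χ_ex(x,y)² = 1` (the exchange sign is `±1`). [cite: Muchane2026, p. 5 (`χ_{p,q}(x,y) ∈ {±1}`)] -/
theorem exchSign_mul_self (x y : Blade n) : exchSign K x y * exchSign K x y = 1 := by
  unfold exchSign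
  rw [← Finset.prod_mul_distrib]
  refine Finset.prod_eq_one fun j _ => ?_
  rw [← Finset.prod_mul_distrib]
  refine Finset.prod_eq_one fun i _ => ?_
  split_ifs
  · exact bsign_mul_self _
  · exact one_mul 1

/-- The metric factor is symmetric: `χ_met(x,y) = χ_met(y,x)`. [cite: Muchane2026, p. 6 ("the metric contribution is symmetric")] -/
theorem metricFactor_comm (q : Fin n → K) (x y : Blade n) :
    metricFactor q x y = metricFactor q y x := by
  unfold metricFactor
  refine Finset.prod_congr rfl fun i _ => ?_
  rw [Bool.and_comm]

/-- The metric factors satisfy the 2-cocycle identity on their own (exponents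
`xᵢyᵢ + (xᵢ+yᵢ)zᵢ = yᵢzᵢ + xᵢ(yᵢ+zᵢ)` coordinatewise, "controlled by a bilinear form").
[cite: AlbuquerqueMajid2002, proof of Prop. 2.1] -/
theorem metricFactor_cocycle (q : Fin n → K) (x y z : Blade n) :
    metricFactor q x y * metricFactor q (x + y) z = metricFactor q y z * metricFactor q x (y + z) := by
  unfold metricFactor
  rw [← Finset.prod_mul_distrib, ← Finset.prod_mul_distrib]
  refine Finset.prod_congr rfl fun i _ => ?_
  rw [add_apply_eq_xor, add_apply_eq_xor]
  cases x i <;> cases y i <;> cases z i <;> simp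

/-- **Albuquerque–Majid, Prop. 2.1: `F` is a 2-cocycle on `(ℤ/2)ⁿ`**, i.e.
`∂F(x,y,z) = F(x,y)F(x+y,z) / (F(y,z)F(x,y+z)) = 1`, here in the division-free form
`F(x,y) F(x⊕y,z) = F(y,z) F(x,y⊕z)`, for ARBITRARY weights `q` (the source assumes `qᵢ ≠ 0` only to
make `F` invertible). This is what makes the twisted product associative (`twConv_assoc`).
[cite: AlbuquerqueMajid2002, Prop. 2.1] -/
theorem twist_cocycle (q : Fin n → K) (x y z : Blade n) :
    twist q x y * twist q (x + y) z = twist q y z * twist q x (y + z) := by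
  unfold twist
  rw [exchSign_add_left, exchSign_add_right]
  have h := metricFactor_cocycle q x y z
  calc exchSign K x y * metricFactor q x y * (exchSign K x z * exchSign K y z * metricFactor q (x + y) z)
        = exchSign K x y * exchSign K x z * exchSign K y z *
            (metricFactor q x y * metricFactor q (x + y) z) := by ring
    _ = exchSign K x y * exchSign K x z * exchSign K y z *
            (metricFactor q y z * metricFactor q x (y + z)) := by rw [h]
    _ = _ := by ring

/-! ### The printed exponent form `χ = (−1)^Φ` -/

/-- The number of exchanges `Σ_{i<j} x_j y_i = #{(j,i) : i < j, x_j = 1, y_i = 1}` — the exponent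
`Φ_ex(x,y)` of the exchange sign. [cite: Muchane2026, p. 8 (first term of `Φ_{p,q}`)] -/
def exchCount (x y : Blade n) : ℕ :=
  (univ.filter fun p : Fin n × Fin n => p.2 < p.1 ∧ x p.1 = true ∧ y p.2 = true).card

/-- The number of repeated negative generators `Σ_{i ≥ p} xᵢ yᵢ` (0-based; the printed 1-based range
is `i = p+1, …, n`) — the exponent `Φ_met(x,y)`. [cite: Muchane2026, p. 8 (second term of `Φ_{p,q}`)] -/
def metCount (p : ℕ) (x y : Blade n) : ℕ :=
  (univ.filter fun i : Fin n => p ≤ (i : ℕ) ∧ x i = true ∧ y i = true).card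

/-- `χ_ex(x,y) = (−1)^{Φ_ex(x,y)}`. [cite: Muchane2026, p. 8] -/
theorem exchSign_eq_neg_one_pow (x y : Blade n) : exchSign K x y = (-1) ^ exchCount x y := by
  unfold exchSign exchCount
  rw [← Finset.prod_const, Finset.prod_filter, Fintype.prod_prod_type]
  refine Finset.prod_congr rfl fun j _ => Finset.prod_congr rfl fun i _ => ?_
  by_cases h : i < j
  · cases x j <;> cases y i <;> simp [h]
  · simp [h]

/-- `χ_met(x,y) = (−1)^{Φ_met(x,y)}` for the signature weights of `Cℓ_{p,q}`. [cite: Muchane2026, p. 8] -/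
theorem metricFactor_sigWeight_eq_neg_one_pow (p : ℕ) (x y : Blade n) :
    metricFactor (sigWeight K p) x y = (-1) ^ metCount p x y := by
  unfold metricFactor metCount sigWeight
  rw [← Finset.prod_const, Finset.prod_filter]
  refine Finset.prod_congr rfl fun i _ => ?_
  by_cases h : p ≤ (i : ℕ)
  · cases x i <;> cases y i <;> simp [h, not_lt.mpr h]
  · have h' : (i : ℕ) < p := lt_of_not_ge h
    cases x i <;> cases y i <;> simp [h, h']

/-- **Muchane's phase polynomial**: `χ_{p,q}(x,y) = (−1)^{Φ_{p,q}(x,y)}` with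
`Φ_{p,q}(x,y) = Σ_{1≤i<j≤n} x_j y_i + Σ_{i=p+1}^{n} x_i y_i (mod 2)`. [cite: Muchane2026, §2.1 p. 7–8] -/
theorem chi_eq_neg_one_pow (p : ℕ) (x y : Blade n) :
    chi K p x y = (-1) ^ (exchCount x y + metCount p x y) := by
  rw [chi, twist, exchSign_eq_neg_one_pow, metricFactor_sigWeight_eq_neg_one_pow, pow_add]

/-- `χ_{p,q}(x,y) ∈ {±1}`: `χ_{p,q}(x,y)² = 1`. [cite: Muchane2026, p. 5] -/
theorem chi_mul_self (p : ℕ) (x y : Blade n) : chi K p x y * chi K p x y = 1 := by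
  rw [chi_eq_neg_one_pow, ← pow_add, ← two_mul, pow_mul, neg_one_sq, one_pow]

/-- Muchane's factorisation `χ_{p,q} = χ_ex · χ_met`. [cite: Muchane2026, p. 6 and p. 8] -/
theorem chi_eq_exchSign_mul_metricFactor (p : ℕ) (x y : Blade n) :
    chi K p x y = exchSign K x y * metricFactor (sigWeight K p) x y := rfl

/-! ### The cocycle on generators: the Clifford relations -/

/-- `χ_ex(δ_a, δ_b) = −1` iff `b < a` (one exchange), else `+1`. [cite: AlbuquerqueMajid2002, proof of Prop. 2.2 ("F(x,y) = 1 in this case" for `i < j`; `e_i · e_j = −e_i e_j` for `j < i`)] -/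
theorem exchSign_gen_gen (a b : Fin n) : exchSign K (gen a) (gen b) = if b < a then -1 else 1 := by
  unfold exchSign
  rw [Finset.prod_eq_single a]
  · rw [Finset.prod_eq_single b]
    · simp
    · intro i _ hi
      simp [gen_apply_of_ne hi]
    · simp
  · intro j _ hj
    refine Finset.prod_eq_one fun i _ => ?_
    simp [gen_apply_of_ne hj]
  · simp

/-- `χ_met(δ_a, δ_b) = q_a` if `a = b`, else `1`. [cite: AlbuquerqueMajid2002, proof of Prop. 2.2 (`e_i · e_i = q_i`)] -/
theorem metricFactor_gen_gen (q : Fin n → K) (a b : Fin n) :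
    metricFactor q (gen a) (gen b) = if a = b then q a else 1 := by
  unfold metricFactor
  rw [Finset.prod_eq_single a]
  · by_cases h : a = b
    · subst h; simp
    · simp [gen_apply_of_ne h, h]
  · intro i _ hi
    simp [gen_apply_of_ne hi]
  · simp

/-- Generators in increasing order multiply without sign: `F(δ_a, δ_b) = 1` for `a < b`
(`e_a · e_b = e_a e_b`). [cite: AlbuquerqueMajid2002, proof of Prop. 2.2] -/
theorem twist_gen_gen_of_lt (q : Fin n → K) {a b : Fin n} (h : a < b) :
    twist q (gen a) (gen b) = 1 := by
  rw [twist, exchSign_gen_gen, metricFactor_gen_gen, if_neg (not_lt.mpr h.le), if_neg h.ne, one_mul]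

/-- Generators in decreasing order pick up a sign: `F(δ_a, δ_b) = −1` for `b < a`
(`e_a · e_b = −e_a e_b = −e_b · e_a`). [cite: AlbuquerqueMajid2002, proof of Prop. 2.2] -/
theorem twist_gen_gen_of_gt (q : Fin n → K) {a b : Fin n} (h : b < a) :
    twist q (gen a) (gen b) = -1 := by
  rw [twist, exchSign_gen_gen, metricFactor_gen_gen, if_pos h, if_neg h.ne', mul_one]

/-- Squares of generators: `F(δ_a, δ_a) = q_a` (`e_a · e_a = q_a 1`; for `Cℓ_{p,q}`: `e_a² = ±1`).
[cite: AlbuquerqueMajid2002, §1.1 (`e_i² = q_i`) and proof of Prop. 2.2; Muchane2026, p. 6 (`e_i² = ±1`)] -/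
theorem twist_gen_self (q : Fin n → K) (a : Fin n) : twist q (gen a) (gen a) = q a := by
  rw [twist, exchSign_gen_gen, metricFactor_gen_gen, if_neg (lt_irrefl _), if_pos rfl, one_mul]

/-- Anticommutation of distinct generators at the level of the cocycle:
`F(δ_a, δ_b) = −F(δ_b, δ_a)` for `a ≠ b`. [cite: AlbuquerqueMajid2002, §1.1 (`e_i e_j + e_j e_i = 0`)] -/
theorem twist_gen_gen_antisymm (q : Fin n → K) {a b : Fin n} (h : a ≠ b) :
    twist q (gen a) (gen b) = -twist q (gen b) (gen a) := by
  rcases lt_or_gt_of_ne h with h | h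
  · rw [twist_gen_gen_of_lt q h, twist_gen_gen_of_gt q h, neg_neg]
  · rw [twist_gen_gen_of_gt q h, twist_gen_gen_of_lt q h]

/-! ### Multivectors and the twisted product `K_F[(ℤ/2)ⁿ]` -/

/-- **Multivector** = its coefficient function `x ↦ a_x` on the `N = 2ⁿ` basis blades
(`A = Σ_x a_x e_x`). [cite: Muchane2026, §2 eq. (1) and p. 6; AlbuquerqueMajid2002, §2 (basis of `k_F G` labelled by `G`)] -/
abbrev MV (n : ℕ) (K : Type*) : Type _ := Blade n → K

/-- The basis blade `e_x` as a multivector (coefficient `1` at `x`, `0` elsewhere). [cite: Muchane2026, §2 'Basis encoding', p. 4] -/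
def bladeVec (K : Type*) [CommRing K] (x : Blade n) : MV n K := fun z => if z = x then 1 else 0

/-- The coefficient of `e_x` in `e_x` is `1`. [folklore] -/
@[simp] private theorem bladeVec_apply_self (x : Blade n) : bladeVec K x x = 1 := if_pos rfl

/-- The coefficient of `e_z` in `e_x` is `0` for `z ≠ x`. [folklore] -/
private theorem bladeVec_apply_of_ne {x z : Blade n} (h : z ≠ x) : bladeVec K x z = 0 := if_neg h

/-- **The geometric product, as printed**: by bilinearity and `e_x e_y = F(x,y) e_{x⊕y}`,
`AB = Σ_{x,y} a_x b_y F(x,y) e_{x⊕y}`; `gp q a b z` is the coefficient of `e_z`, i.e. the sum over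
the pairs `(x,y)` with `x ⊕ y = z`. This is the product `a · b = F(a,b) ab` of the twisted group
algebra `K_F[(ℤ/2)ⁿ]` extended bilinearly. [cite: Muchane2026, §2 eq. (1) and p. 6 (`AB = Σ_{x,y} a_x b_y χ_{p,q}(x,y) e_{x⊕y}`); AlbuquerqueMajid2002, §2 eq. (4) (`a · b = F(a,b) ab`)] -/
def gp (q : Fin n → K) (a b : MV n K) : MV n K :=
  fun z => ∑ x : Blade n, ∑ y : Blade n, if x + y = z then twist q x y * a x * b y else 0

/-- **Cocycle-twisted convolution** `c_z = Σ_x a_x b_{x⊕z} χ(x, x⊕z) = (a ∗_χ b)(z)`.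
[cite: Muchane2026, p. 6–7 (`c_z = Σ_{x⊕y=z} a_x b_y χ_{p,q}(x,y) = Σ_x a_x b_{x⊕z} χ_{p,q}(x,x⊕z)`, `(f ∗_χ g)(z) = Σ_x f(x) g(x⊕z) χ(x,x⊕z)`)] -/
def twConv (q : Fin n → K) (a b : MV n K) : MV n K :=
  fun z => ∑ x : Blade n, a x * b (x + z) * twist q x (x + z)

/-- **"Grouping together those having the same output blade `z = x ⊕ y`"**: the coefficient of `e_z`
in `AB` is the cocycle-twisted convolution `c_z`. [cite: Muchane2026, p. 6] -/
theorem gp_eq_twConv (q : Fin n → K) (a b : MV n K) : gp q a b = twConv q a b := by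
  funext z
  unfold gp twConv
  refine Finset.sum_congr rfl fun x _ => ?_
  simp_rw [add_eq_iff_eq_add x _ z]
  rw [Finset.sum_ite_eq' univ (x + z)]
  simp only [Finset.mem_univ, if_true]
  ring

/-- **The multiplication law of basis blades**: `e_x e_y = F(x,y) e_{x⊕y}` — "the XOR operation
determines the output blade, while the Clifford cocycle encodes the orientation". [cite: Muchane2026, §2 p. 5 (`e_x e_y = χ_{p,q}(x,y) e_{x⊕y}`, Table 1); AlbuquerqueMajid2002, §2 eq. (4)] -/
theorem gp_bladeVec_bladeVec (q : Fin n → K) (x y : Blade n) :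
    gp q (bladeVec K x) (bladeVec K y) = twist q x y • bladeVec K (x + y) := by
  funext z
  rw [gp_eq_twConv]
  simp only [twConv, bladeVec, Pi.smul_apply, smul_eq_mul]
  rw [Finset.sum_eq_single x]
  · by_cases h : z = x + y
    · subst h
      simp [add_add_cancel_left]
    · have h' : ¬ (x + z = y) := fun h'' => h ((add_eq_iff_eq_add x z y).mp h'')
      simp [h, h']
  · intro x' _ hx'
    simp [hx']
  · simp

/-- `e_∅ = e_0` is a left unit of the twisted product (`F(0,y) = 1`). [cite: AlbuquerqueMajid2002, §2 (normalised cochain)] -/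
theorem gp_one_left (q : Fin n → K) (a : MV n K) : gp q (bladeVec K 0) a = a := by
  funext z
  rw [gp_eq_twConv]
  simp only [twConv, bladeVec]
  rw [Finset.sum_eq_single 0]
  · simp
  · intro x _ hx
    simp [hx]
  · simp

/-- `e_∅ = e_0` is a right unit of the twisted product (`F(x,0) = 1`). [cite: AlbuquerqueMajid2002, §2 (normalised cochain)] -/
theorem gp_one_right (q : Fin n → K) (a : MV n K) : gp q a (bladeVec K 0) = a := by
  funext z
  rw [gp_eq_twConv]
  simp only [twConv, bladeVec]
  rw [Finset.sum_eq_single z]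
  · simp [blade_add_self]
  · intro x _ hx
    have : x + z ≠ 0 := fun h => hx (by
      have := (add_eq_iff_eq_add x z 0).mp h
      rw [this, add_zero])
    simp [this]
  · simp

/-- **Associativity of the cocycle-twisted convolution** — "because the coboundary `∂F = 1`, the
new algebra remains associative": `(a ∗ b) ∗ c = a ∗ (b ∗ c)`, a direct consequence of the
2-cocycle identity `twist_cocycle`. [cite: AlbuquerqueMajid2002, §2 (after Prop. 2.1); Muchane2026, p. 6 (`Cℓ_{p,q}(K) ≅ K^χ[(ℤ₂)ⁿ]`)] -/
theorem twConv_assoc (q : Fin n → K) (a b c : MV n K) :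
    twConv q (twConv q a b) c = twConv q a (twConv q b c) := by
  funext z
  simp only [twConv]
  simp_rw [Finset.mul_sum, Finset.sum_mul]
  conv_lhs => rw [Finset.sum_comm]
  refine Finset.sum_congr rfl fun x _ => ?_
  refine Fintype.sum_equiv (Equiv.addLeft x) _ _ fun u => ?_
  simp only [Equiv.coe_addLeft]
  have h1 : x + (x + u) = u := add_add_cancel_left x u
  have h2 : (x + u) + (x + z) = u + z := add_add_add_cancel x u z
  have h3 : (x + u) + (u + z) = x + z := by
    rw [add_assoc, ← add_assoc u, blade_add_self, zero_add]
  have hc := twist_cocycle q x (x + u) (u + z)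
  rw [h1, h3] at hc
  rw [h2]
  calc a x * b (x + u) * twist q x (x + u) * c (u + z) * twist q u (u + z)
        = a x * b (x + u) * c (u + z) * (twist q x (x + u) * twist q u (u + z)) := by ring
    _ = a x * b (x + u) * c (u + z) * (twist q (x + u) (u + z) * twist q x (x + z)) := by rw [hc]
    _ = _ := by ring

/-- **Associativity of the geometric product** on coefficient vectors (the twisted group algebra
`K_F[(ℤ/2)ⁿ]` is associative). [cite: AlbuquerqueMajid2002, §2; Muchane2026, p. 6] -/
theorem gp_assoc (q : Fin n → K) (a b c : MV n K) : gp q (gp q a b) c = gp q a (gp q b c) := by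
  simp only [gp_eq_twConv, twConv_assoc]

/-- **Clifford relation, distinct generators**: `e_a e_b + e_b e_a = 0` (`a ≠ b`) in `K_F[(ℤ/2)ⁿ]`.
[cite: AlbuquerqueMajid2002, §1.1 (`e_i e_j + e_j e_i = 0 ∀ i ≠ j`) and Prop. 2.2] -/
theorem gp_gen_gen_add_gp_gen_gen (q : Fin n → K) {a b : Fin n} (h : a ≠ b) :
    gp q (bladeVec K (gen a)) (bladeVec K (gen b)) + gp q (bladeVec K (gen b)) (bladeVec K (gen a)) = 0 := by
  rw [gp_bladeVec_bladeVec, gp_bladeVec_bladeVec, add_comm (gen b) (gen a),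
    twist_gen_gen_antisymm q h, neg_smul, neg_add_cancel]

/-- **Clifford relation, squares**: `e_a e_a = q_a · 1` in `K_F[(ℤ/2)ⁿ]` (for `Cℓ_{p,q}`:
`e_a² = ±1`). [cite: AlbuquerqueMajid2002, §1.1 (`e_i² = q_i · 1`) and Prop. 2.2; Muchane2026, p. 6] -/
theorem gp_gen_gen_self (q : Fin n → K) (a : Fin n) :
    gp q (bladeVec K (gen a)) (bladeVec K (gen a)) = q a • bladeVec K 0 := by
  rw [gp_bladeVec_bladeVec, blade_add_self, twist_gen_self]

/-! ### Muchane's Theorem 2.5: the circuit `U_χ`, `U_⊕`, `H^{⊗n}` and its trivial-character branch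

Amplitudes of the two `n`-qubit registers are functions `Blade n → Blade n → ℂ`
(`ψ x y` = amplitude of `|x⟩|y⟩`). The three maps of the printed proof act on them as below; the
formalised content of Theorem 2.5 is the STATE IDENTITY of its proof (the `w = 0ⁿ` branch after the
three maps carries `2^{-n/2} c_z`, hence has squared norm `p₀ = 2^{-n} Σ_z |c_z|²`) together with
the norm preservation of `U_χ` and `U_⊕`; the gate-count clause ("an `O(n)` circuit") and the
synthesis of `U_χ` (Lemmas 2.1–2.3, Prop. 2.4) are not formalised here. -/

/-- Two-register amplitude function: `ψ x y` is the amplitude of `|x⟩ ⊗ |y⟩`. [cite: Muchane2026, §2.1 eq. (2) and proof of Thm. 2.5, p. 13] -/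
abbrev State₂ (n : ℕ) : Type := Blade n → Blade n → ℂ

/-- The input `|A⟩|B⟩ = Σ_{x,y} a_x b_y |x⟩|y⟩` (amplitude encodings of the two multivectors).
[cite: Muchane2026, Thm. 2.5 and its proof, p. 13] -/
def tensorState (a b : MV n ℂ) : State₂ n := fun x y => a x * b y

/-- The cocycle phase oracle `U_χ : |x⟩|y⟩ ↦ χ(x,y) |x⟩|y⟩` (diagonal). [cite: Muchane2026, proof of Thm. 2.5, p. 13; §2.1 'The cocycle oracle'] -/
def phaseOracle (q : Fin n → ℂ) (ψ : State₂ n) : State₂ n := fun x y => twist q x y * ψ x y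

/-- The reversible XOR map `U_⊕ : |x⟩|y⟩ ↦ |x⟩|x ⊕ y⟩`: the new amplitude of `|x⟩|z⟩` is the old
amplitude of `|x⟩|x ⊕ z⟩` (since `y = x ⊕ z`). [cite: Muchane2026, proof of Thm. 2.5, p. 13] -/
def xorMap (ψ : State₂ n) : State₂ n := fun x z => ψ x (x + z)

/-- The Walsh character `(−1)^{w·x}` of `(ℤ/2)ⁿ`. [cite: Muchane2026, proof of Thm. 2.5, p. 13 (`H^{⊗n}|x⟩ = 2^{-n/2} Σ_w (−1)^{w·x} |w⟩`)] -/
def walsh (w x : Blade n) : ℂ := ∏ i : Fin n, bsign ℂ (w i && x i)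

/-- The normalisation `2^{-n/2} = (√2)⁻ⁿ` of `H^{⊗n}`, as a real number. [cite: Muchane2026, p. 13] -/
def hadamardNorm (n : ℕ) : ℝ := (Real.sqrt 2)⁻¹ ^ n

/-- `H^{⊗n}` on the FIRST register: `ψ ↦ ((w,z) ↦ 2^{-n/2} Σ_x (−1)^{w·x} ψ x z)`.
[cite: Muchane2026, proof of Thm. 2.5, p. 13] -/
def hadamardFirst (ψ : State₂ n) : State₂ n :=
  fun w z => (hadamardNorm n : ℂ) * ∑ x : Blade n, walsh w x * ψ x z

/-- The output state of Muchane's circuit (before post-selection):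
`(H^{⊗n} ⊗ 1) U_⊕ U_χ (|A⟩ ⊗ |B⟩)`. [cite: Muchane2026, Thm. 2.5 / Fig. 4, p. 13] -/
def circuitState (q : Fin n → ℂ) (a b : MV n ℂ) : State₂ n :=
  hadamardFirst (xorMap (phaseOracle q (tensorState a b)))

/-- The trivial character: `(−1)^{0·x} = 1`. [folklore] -/
@[simp] private theorem walsh_zero_left (x : Blade n) : walsh 0 x = 1 := by
  simp [walsh]

/-- `2^{-n/2} ≥ 0`. [folklore] -/
private theorem hadamardNorm_nonneg (n : ℕ) : 0 ≤ hadamardNorm n := by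
  unfold hadamardNorm; positivity

/-- `(2^{-n/2})² = 2^{-n}`. [folklore] -/
private theorem hadamardNorm_sq (n : ℕ) : hadamardNorm n ^ 2 = ((2 : ℝ) ^ n)⁻¹ := by
  unfold hadamardNorm
  rw [← pow_mul, mul_comm, pow_mul, inv_pow, Real.sq_sqrt (by norm_num : (0:ℝ) ≤ 2), inv_pow]

/-- After `U_χ` and `U_⊕` the state is `Σ_{x,z} a_x b_{x⊕z} χ(x, x⊕z) |x⟩|z⟩`.
[cite: Muchane2026, proof of Thm. 2.5, p. 13 (the displayed `|ψ⟩`)] -/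
theorem xorMap_phaseOracle_tensorState (q : Fin n → ℂ) (a b : MV n ℂ) (x z : Blade n) :
    xorMap (phaseOracle q (tensorState a b)) x z = a x * b (x + z) * twist q x (x + z) := by
  simp only [xorMap, phaseOracle, tensorState]
  ring

/-- **Muchane, Theorem 2.5 (state identity of the proof).** In the output state of the circuit, the
amplitude of `|0ⁿ⟩|z⟩` (the trivial-character branch of the first register) is `2^{-n/2} c_z`,
where `c_z` is the `z`-th coefficient of the Clifford product `AB` — "the inner sum is exactly the
`z`-th coefficient of the Clifford product". Holds for every weight vector `q` (every `Cℓ_{p,q}` via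
`q = sigWeight ℂ p`, and complexified algebras alike). [cite: Muchane2026, Thm. 2.5 and proof, pp. 13–14] -/
theorem circuitState_zero (q : Fin n → ℂ) (a b : MV n ℂ) (z : Blade n) :
    circuitState q a b 0 z = (hadamardNorm n : ℂ) * twConv q a b z := by
  simp only [circuitState, hadamardFirst, xorMap_phaseOracle_tensorState, walsh_zero_left, one_mul,
    twConv]

/-- The same identity with the coefficient written as the printed double sum `gp`
(`AB = Σ_z c_z e_z`). [cite: Muchane2026, Thm. 2.5, pp. 13–14] -/
theorem circuitState_zero_eq_gp (q : Fin n → ℂ) (a b : MV n ℂ) (z : Blade n) :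
    circuitState q a b 0 z = (hadamardNorm n : ℂ) * gp q a b z := by
  rw [circuitState_zero, gp_eq_twConv]

/-- **Muchane, Theorem 2.5 (success probability).** The squared norm of the trivial-character branch
— the probability of reading `0ⁿ` on the first register when the input registers are normalised —
is `p₀ = 2^{-n} Σ_z |c_z|²`. [cite: Muchane2026, Thm. 2.5, p. 13 (`p₀ = 2^{-n} Σ_z |c_z|²`) and p. 14] -/
theorem circuitState_zero_norm_sq (q : Fin n → ℂ) (a b : MV n ℂ) :
    ∑ z : Blade n, ‖circuitState q a b 0 z‖ ^ 2 = ((2 : ℝ) ^ n)⁻¹ * ∑ z : Blade n, ‖twConv q a b z‖ ^ 2 := by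
  simp_rw [circuitState_zero, norm_mul, mul_pow, ← Finset.mul_sum, Complex.norm_real, Real.norm_eq_abs,
    sq_abs, hadamardNorm_sq]

/-! #### Norm preservation of `U_χ` and `U_⊕` (so that `p₀` is a probability) -/

/-- For `±1` weights (every `Cℓ_{p,q}`), the cocycle values are unimodular: `‖χ_{p,q}(x,y)‖ = 1`.
[cite: Muchane2026, p. 5 (`χ_{p,q}(x,y) ∈ {±1}`)] -/
theorem norm_chi (p : ℕ) (x y : Blade n) : ‖(chi ℂ p x y : ℂ)‖ = 1 := by
  have h := chi_mul_self (K := ℂ) p x y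
  have h2 : ‖(chi ℂ p x y : ℂ)‖ * ‖(chi ℂ p x y : ℂ)‖ = 1 := by rw [← norm_mul, h, norm_one]
  have h0 : 0 ≤ ‖(chi ℂ p x y : ℂ)‖ := norm_nonneg _
  nlinarith [h2, h0]

/-- `U_χ` preserves the norm of the two-register state (it is a diagonal `±1` phase).
[cite: Muchane2026, §2.1 ('a diagonal cocycle phase oracle'), proof of Thm. 2.5] -/
theorem norm_sq_phaseOracle (p : ℕ) (ψ : State₂ n) :
    ∑ x : Blade n, ∑ y : Blade n, ‖phaseOracle (sigWeight ℂ p) ψ x y‖ ^ 2 =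
      ∑ x : Blade n, ∑ y : Blade n, ‖ψ x y‖ ^ 2 := by
  refine Finset.sum_congr rfl fun x _ => Finset.sum_congr rfl fun y _ => ?_
  rw [phaseOracle, norm_mul, ← chi, norm_chi, one_mul]

/-- `U_⊕` preserves the norm of the two-register state (it permutes the computational basis).
[cite: Muchane2026, proof of Thm. 2.5 ('the reversible XOR map')] -/
theorem norm_sq_xorMap (ψ : State₂ n) :
    ∑ x : Blade n, ∑ z : Blade n, ‖xorMap ψ x z‖ ^ 2 = ∑ x : Blade n, ∑ y : Blade n, ‖ψ x y‖ ^ 2 := by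
  refine Finset.sum_congr rfl fun x _ => ?_
  exact Fintype.sum_equiv (Equiv.addLeft x) _ _ fun z => by simp [xorMap]

/-! #### `H^{⊗n}` is norm preserving (Parseval on `(ℤ/2)ⁿ`), hence so is the whole circuit -/

/-- Walsh characters multiply by symmetric difference of their index sets:
`χ_S(x) χ_T(x) = χ_{S△T}(x)`, i.e. `(−1)^{(w⊕w')·x} = (−1)^{w·x}(−1)^{w'·x}`. [cite: ODonnell2014, Fact 1.6] -/
theorem walsh_add_left (w w' x : Blade n) : walsh (w + w') x = walsh w x * walsh w' x := by
  unfold walsh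
  rw [← Finset.prod_mul_distrib]
  refine Finset.prod_congr rfl fun i _ => ?_
  rw [add_apply_eq_xor, bsign_xor_and]

/-- Walsh characters are multiplicative in the argument (they are characters of `(ℤ/2)ⁿ`):
`(−1)^{w·(x⊕x')} = (−1)^{w·x}(−1)^{w·x'}`. [folklore] -/
private theorem walsh_add_right (w x x' : Blade n) : walsh w (x + x') = walsh w x * walsh w x' := by
  unfold walsh
  rw [← Finset.prod_mul_distrib]
  refine Finset.prod_congr rfl fun i _ => ?_
  rw [add_apply_eq_xor, bsign_and_xor]

/-- The character `δ_i` evaluates to `(−1)^{x_i}`. [folklore] -/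
private theorem walsh_gen_left (i : Fin n) (x : Blade n) : walsh (gen i) x = bsign ℂ (x i) := by
  unfold walsh
  rw [Finset.prod_eq_single i]
  · simp
  · intro j _ hj
    simp [gen_apply_of_ne hj]
  · simp

/-- Walsh characters are real: `conj (−1)^{w·x} = (−1)^{w·x}`. [folklore] -/
private theorem conj_walsh (w x : Blade n) : (starRingEnd ℂ) (walsh w x) = walsh w x := by
  unfold walsh
  rw [map_prod]
  refine Finset.prod_congr rfl fun i _ => ?_
  cases (w i && x i) <;> simp

/-- The number of blade indices is `N = 2ⁿ`. [cite: Muchane2026, §2 p. 3 (`N = 2ⁿ` basis blades)] -/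
theorem card_blade (n : ℕ) : Fintype.card (Blade n) = 2 ^ n := by
  simp

/-- **Orthogonality of Walsh characters** (O'Donnell's Fact 1.7, `E_x[χ_S(x)] = [S = ∅]`, scaled by
`2ⁿ` and with the roles of index set and argument exchanged — `(−1)^{w·y}` is symmetric in `(w, y)`):
`Σ_w (−1)^{w·y} = 2ⁿ` if `y = 0` and `0` otherwise. [cite: ODonnell2014, Fact 1.7 and Thm. 1.5] -/
theorem sum_walsh (y : Blade n) : ∑ w : Blade n, walsh w y = if y = 0 then (2 : ℂ) ^ n else 0 := by
  split_ifs with hy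
  · subst hy
    have : ∀ w : Blade n, walsh w 0 = 1 := fun w => by simp [walsh]
    simp [this]
  · obtain ⟨i, hi⟩ := Function.ne_iff.mp hy
    have hi' : y i = true := by
      cases h : y i
      · exact absurd h hi
      · rfl
    set S := ∑ w : Blade n, walsh w y with hS
    have hre : S = ∑ w : Blade n, walsh (gen i + w) y :=
      Fintype.sum_equiv (Equiv.addLeft (gen i)) _ _ fun w => by
        rw [Equiv.coe_addLeft, add_add_cancel_left]
    have hneg : S = -S := by
      calc S = ∑ w : Blade n, walsh (gen i + w) y := hre
        _ = ∑ w : Blade n, -walsh w y := by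
            refine Finset.sum_congr rfl fun w _ => ?_
            rw [walsh_add_left, walsh_gen_left, hi', bsign_true]; ring
        _ = -S := by rw [Finset.sum_neg_distrib]
    have h2 : (2 : ℂ) * S = 0 := by linear_combination hneg
    simpa using h2

/-- **Parseval for the Walsh–Hadamard transform** (unitarity of `H^{⊗n}` up to the factor `2ⁿ`):
`Σ_w |Σ_x (−1)^{w·x} f(x)|² = 2ⁿ Σ_x |f(x)|²`. O'Donnell states Parseval for real-valued `f` in the
normalised form `E_x[f(x)²] = Σ_S f̂(S)²`; this is the same identity for `ℂ`-valued amplitudes with the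
unnormalised transform `Σ_x (−1)^{w·x} f(x) = 2ⁿ f̂(w)`. [cite: ODonnell2014, §1.4 'Parseval's Theorem'] -/
theorem sum_norm_sq_walsh_transform (f : Blade n → ℂ) :
    ∑ w : Blade n, ‖∑ x : Blade n, walsh w x * f x‖ ^ 2 = (2 : ℝ) ^ n * ∑ x : Blade n, ‖f x‖ ^ 2 := by
  -- pass to `ℂ`, where `‖s‖² = s · conj s`
  have key : ∀ w : Blade n, ((‖∑ x : Blade n, walsh w x * f x‖ ^ 2 : ℝ) : ℂ) =
      ∑ x : Blade n, ∑ x' : Blade n, f x * (starRingEnd ℂ) (f x') * walsh w (x + x') := by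
    intro w
    rw [← Complex.normSq_eq_norm_sq, ← Complex.mul_conj, map_sum, Finset.sum_mul_sum]
    refine Finset.sum_congr rfl fun x _ => Finset.sum_congr rfl fun x' _ => ?_
    rw [map_mul, conj_walsh, walsh_add_right]
    ring
  apply Complex.ofReal_injective
  rw [Complex.ofReal_sum, Complex.ofReal_mul, Complex.ofReal_sum, Complex.ofReal_pow,
    Complex.ofReal_ofNat]
  simp_rw [key]
  rw [Finset.sum_comm, Finset.mul_sum]
  refine Finset.sum_congr rfl fun x _ => ?_
  rw [Finset.sum_comm]
  simp_rw [← Finset.mul_sum, sum_walsh]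
  rw [Finset.sum_eq_single x]
  · rw [blade_add_self, if_pos rfl, Complex.mul_conj, Complex.normSq_eq_norm_sq]
    push_cast
    ring
  · intro x' _ hx'
    have : x + x' ≠ 0 := fun h => hx' (by
      have := (add_eq_iff_eq_add x x' 0).mp h
      rw [this, add_zero])
    rw [if_neg this, mul_zero]
  · simp

/-- **`H^{⊗n} ⊗ 1` preserves the norm** of the two-register state. [cite: Muchane2026, proof of Thm. 2.5 (the Walsh–Hadamard transform on the first register)] -/
theorem norm_sq_hadamardFirst (ψ : State₂ n) :
    ∑ w : Blade n, ∑ z : Blade n, ‖hadamardFirst ψ w z‖ ^ 2 =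
      ∑ x : Blade n, ∑ z : Blade n, ‖ψ x z‖ ^ 2 := by
  rw [Finset.sum_comm]
  conv_rhs => rw [Finset.sum_comm]
  refine Finset.sum_congr rfl fun z _ => ?_
  simp only [hadamardFirst]
  simp_rw [norm_mul, mul_pow, ← Finset.mul_sum, Complex.norm_real, Real.norm_eq_abs, sq_abs,
    hadamardNorm_sq, sum_norm_sq_walsh_transform (fun x => ψ x z)]
  rw [← mul_assoc, inv_mul_cancel₀ (by positivity), one_mul]

/-- **The whole circuit is norm preserving** (for the `±1` weights of any `Cℓ_{p,q}`): if the input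
registers are normalised, `Σ_{w,z} |output amplitude|² = Σ_{x,y} |a_x b_y|²`, so `circuitState_zero_norm_sq`
is the probability of the post-selected outcome `0ⁿ`. [cite: Muchane2026, Thm. 2.5 ('The success probability of this branch is p₀ = 2^{-n} Σ_z |c_z|²')] -/
theorem norm_sq_circuitState (p : ℕ) (a b : MV n ℂ) :
    ∑ w : Blade n, ∑ z : Blade n, ‖circuitState (sigWeight ℂ p) a b w z‖ ^ 2 =
      ∑ x : Blade n, ∑ y : Blade n, ‖a x * b y‖ ^ 2 := by
  rw [circuitState, norm_sq_hadamardFirst, norm_sq_xorMap, norm_sq_phaseOracle]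
  rfl

/-- With normalised inputs `Σ|a_x|² = Σ|b_y|² = 1` the output state is normalised, and the success
probability of Theorem 2.5 reads `p₀ = Σ_z |⟨0ⁿ z|out⟩|² = 2^{-n} Σ_z |c_z|²` with `Σ_{w,z}|⟨w z|out⟩|² = 1`.
[cite: Muchane2026, Thm. 2.5, pp. 13–14] -/
theorem successProbability (p : ℕ) (a b : MV n ℂ)
    (ha : ∑ x : Blade n, ‖a x‖ ^ 2 = 1) (hb : ∑ y : Blade n, ‖b y‖ ^ 2 = 1) :
    (∑ w : Blade n, ∑ z : Blade n, ‖circuitState (sigWeight ℂ p) a b w z‖ ^ 2 = 1) ∧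
    (∑ z : Blade n, ‖circuitState (sigWeight ℂ p) a b 0 z‖ ^ 2 =
      ((2 : ℝ) ^ n)⁻¹ * ∑ z : Blade n, ‖twConv (sigWeight ℂ p) a b z‖ ^ 2) := by
  refine ⟨?_, circuitState_zero_norm_sq _ a b⟩
  rw [norm_sq_circuitState]
  simp_rw [norm_mul, mul_pow, ← Finset.mul_sum, hb, mul_one, ha]

/-! ### Muchane's Table 1 (`Cℓ_{3,0}(ℝ)`, `n = p = 3`): the eight printed products, checked

Indices are written `![x₁, x₂, x₃]` (generator `e₁` first); e.g. `e₁₃ = ![true, false, true]`. -/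

section Table1

/-- Row 1, `1 · 1 = +1`: `χ_{3,0}(000, 000) = +1`. [cite: Muchane2026, Table 1, p. 5] -/
example : chi ℤ 3 (n := 3) ![false, false, false] ![false, false, false] = 1 := by decide

/-- Row 2, `e₁ e₂ = +e₁₂`: `χ_{3,0}(001, 010) = +1`. [cite: Muchane2026, Table 1, p. 5] -/
example : chi ℤ 3 (n := 3) ![true, false, false] ![false, true, false] = 1 := by decide

/-- Row 3, `e₂ e₁₃ = −e₁₂₃`: `χ_{3,0}(010, 101) = −1`, output index `010 ⊕ 101 = 111`.
[cite: Muchane2026, Table 1, p. 5] -/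
example : chi ℤ 3 (n := 3) ![false, true, false] ![true, false, true] = -1 ∧
    ((![false, true, false] : Blade 3) + ![true, false, true] = ![true, true, true]) := by decide

/-- Row 4, `e₁₂ e₁₂₃ = −e₃`: `χ_{3,0}(011, 111) = −1`, output `011 ⊕ 111 = 100`.
[cite: Muchane2026, Table 1, p. 5] -/
example : chi ℤ 3 (n := 3) ![true, true, false] ![true, true, true] = -1 ∧
    ((![true, true, false] : Blade 3) + ![true, true, true] = ![false, false, true]) := by decide

/-- Row 5, `e₃ e₁ = −e₁₃`: `χ_{3,0}(100, 001) = −1`. [cite: Muchane2026, Table 1, p. 5] -/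
example : chi ℤ 3 (n := 3) ![false, false, true] ![true, false, false] = -1 := by decide

/-- Row 6, `e₁₃ e₁₂ = +e₂₃`: `χ_{3,0}(101, 011) = +1`, output `101 ⊕ 011 = 110`.
[cite: Muchane2026, Table 1, p. 5] -/
example : chi ℤ 3 (n := 3) ![true, false, true] ![true, true, false] = 1 ∧
    ((![true, false, true] : Blade 3) + ![true, true, false] = ![false, true, true]) := by decide

/-- Row 7, `e₂₃ e₃ = +e₂`: `χ_{3,0}(110, 100) = +1`. [cite: Muchane2026, Table 1, p. 5] -/
example : chi ℤ 3 (n := 3) ![false, true, true] ![false, false, true] = 1 := by decide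

/-- Row 8, `e₁₂₃ e₂₃ = −e₁`: `χ_{3,0}(111, 110) = −1`, output `111 ⊕ 110 = 001`.
[cite: Muchane2026, Table 1, p. 5] -/
example : chi ℤ 3 (n := 3) ![true, true, true] ![false, true, true] = -1 ∧
    ((![true, true, true] : Blade 3) + ![false, true, true] = ![true, false, false]) := by decide

/-- A negative-signature square, `Cℓ_{0,1} ≅ ℂ`: `e₁ e₁ = −1` (`χ_{0,1}(1,1) = −1`).
[cite: Muchane2026, p. 8 (metric term, `e_i² = −1` for `i > p`)] -/
example : chi ℤ 0 (n := 1) ![true] ![true] = -1 := by decide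

end Table1

/-! ### Bilinearity of the twisted product, the Clifford relation for vectors, and the universal
map from Mathlib's `CliffordAlgebra` (Albuquerque–Majid Prop. 2.2) -/

/-- The twisted product is additive in the left factor. [cite: AlbuquerqueMajid2002, §2 (the product of `k_F G` is the bilinear extension of `a · b = F(a,b) ab`)] -/
theorem twConv_add_left (q : Fin n → K) (a a' b : MV n K) :
    twConv q (a + a') b = twConv q a b + twConv q a' b := by
  funext z
  simp only [twConv, Pi.add_apply, ← Finset.sum_add_distrib]
  exact Finset.sum_congr rfl fun x _ => by ring

/-- The twisted product is additive in the right factor. [cite: AlbuquerqueMajid2002, §2] -/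
theorem twConv_add_right (q : Fin n → K) (a b b' : MV n K) :
    twConv q a (b + b') = twConv q a b + twConv q a b' := by
  funext z
  simp only [twConv, Pi.add_apply, ← Finset.sum_add_distrib]
  exact Finset.sum_congr rfl fun x _ => by ring

/-- The twisted product is homogeneous in the left factor. [cite: AlbuquerqueMajid2002, §2] -/
theorem twConv_smul_left (q : Fin n → K) (c : K) (a b : MV n K) :
    twConv q (c • a) b = c • twConv q a b := by
  funext z
  simp only [twConv, Pi.smul_apply, smul_eq_mul, Finset.mul_sum]
  exact Finset.sum_congr rfl fun x _ => by ring

/-- The twisted product is homogeneous in the right factor. [cite: AlbuquerqueMajid2002, §2] -/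
theorem twConv_smul_right (q : Fin n → K) (c : K) (a b : MV n K) :
    twConv q a (c • b) = c • twConv q a b := by
  funext z
  simp only [twConv, Pi.smul_apply, smul_eq_mul, Finset.mul_sum]
  exact Finset.sum_congr rfl fun x _ => by ring

/-- `0 · b = 0`. [cite: AlbuquerqueMajid2002, §2] -/
theorem twConv_zero_left (q : Fin n → K) (b : MV n K) : twConv q 0 b = 0 := by
  funext z; simp [twConv]

/-- `a · 0 = 0`. [cite: AlbuquerqueMajid2002, §2] -/
theorem twConv_zero_right (q : Fin n → K) (a : MV n K) : twConv q a 0 = 0 := by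
  funext z; simp [twConv]

/-- `gp` in sums, left factor. [cite: AlbuquerqueMajid2002, §2] -/
theorem gp_sum_left (q : Fin n → K) {ι : Type*} (s : Finset ι) (a : ι → MV n K) (b : MV n K) :
    gp q (∑ i ∈ s, a i) b = ∑ i ∈ s, gp q (a i) b := by
  classical
  induction s using Finset.induction_on with
  | empty => simp [gp_eq_twConv, twConv_zero_left]
  | insert i s hi ih => rw [Finset.sum_insert hi, Finset.sum_insert hi, gp_eq_twConv, twConv_add_left,
      ← gp_eq_twConv, ← gp_eq_twConv, ih]

/-- `gp` in sums, right factor. [cite: AlbuquerqueMajid2002, §2] -/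
theorem gp_sum_right (q : Fin n → K) {ι : Type*} (s : Finset ι) (a : MV n K) (b : ι → MV n K) :
    gp q a (∑ i ∈ s, b i) = ∑ i ∈ s, gp q a (b i) := by
  classical
  induction s using Finset.induction_on with
  | empty => simp [gp_eq_twConv, twConv_zero_right]
  | insert i s hi ih => rw [Finset.sum_insert hi, Finset.sum_insert hi, gp_eq_twConv, twConv_add_right,
      ← gp_eq_twConv, ← gp_eq_twConv, ih]

/-- `gp (c • a) b = c • gp a b`. [cite: AlbuquerqueMajid2002, §2] -/
theorem gp_smul_left (q : Fin n → K) (c : K) (a b : MV n K) : gp q (c • a) b = c • gp q a b := by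
  simp only [gp_eq_twConv, twConv_smul_left]

/-- `gp a (c • b) = c • gp a b`. [cite: AlbuquerqueMajid2002, §2] -/
theorem gp_smul_right (q : Fin n → K) (c : K) (a b : MV n K) : gp q a (c • b) = c • gp q a b := by
  simp only [gp_eq_twConv, twConv_smul_right]

/-- **The vector `v = Σᵢ vᵢ eᵢ ∈ V ⊂ C(V, q)`** inside the twisted group algebra ("We identify `k`
and `V` inside `C(V, q)` in the obvious way"). [cite: AlbuquerqueMajid2002, §1.1] -/
def vec (K : Type*) [CommRing K] (v : Fin n → K) : MV n K := ∑ i : Fin n, v i • bladeVec K (gen i)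

/-- **The Clifford relation for vectors** in `K_F[(ℤ/2)ⁿ]`: `v · v = q(v) 1` with
`q(v) = Σᵢ qᵢ vᵢ²` the diagonal form `q(eᵢ) = qᵢ` — the defining relation of `C(V, q)`, obtained
from `eᵢ·eᵢ = qᵢ` and `eᵢ·eⱼ + eⱼ·eᵢ = 0`. [cite: AlbuquerqueMajid2002, §1.1 and Prop. 2.2] -/
theorem gp_vec_vec (q : Fin n → K) (v : Fin n → K) :
    gp q (vec K v) (vec K v) = (∑ i : Fin n, q i * (v i * v i)) • bladeVec K 0 := by
  unfold vec
  rw [gp_sum_left]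
  simp_rw [gp_sum_right, gp_smul_left, gp_smul_right]
  -- Σ_i Σ_j v_j • v_i • e_i e_j : split the diagonal from the off-diagonal pairs
  rw [← Finset.sum_product' (f := fun i j => v i • v j • gp q (bladeVec K (gen i)) (bladeVec K (gen j))),
    ← Finset.diag_union_offDiag, Finset.sum_union (Finset.disjoint_diag_offDiag _), Finset.sum_diag]
  have hoff : ∑ ij ∈ (univ : Finset (Fin n)).offDiag,
      v ij.1 • v ij.2 • gp q (bladeVec K (gen ij.1)) (bladeVec K (gen ij.2)) = 0 := by
    refine Finset.sum_involution (fun ij _ => (ij.2, ij.1)) ?_ ?_ ?_ ?_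
    · intro ij hij
      have hne : ij.1 ≠ ij.2 := (Finset.mem_offDiag.mp hij).2.2
      rw [smul_smul, smul_smul, mul_comm (v ij.2) (v ij.1), ← smul_add,
        gp_gen_gen_add_gp_gen_gen q hne, smul_zero]
    · intro ij hij _
      have hne : ij.1 ≠ ij.2 := (Finset.mem_offDiag.mp hij).2.2
      intro h
      exact hne (Prod.ext_iff.mp h).2
    · intro ij hij
      simp only [Finset.mem_offDiag, Finset.mem_univ, true_and] at hij ⊢
      exact Ne.symm hij
    · intro ij _
      rfl
  rw [hoff, add_zero, Finset.sum_smul]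
  refine Finset.sum_congr rfl fun i _ => ?_
  rw [gp_gen_gen_self, smul_smul, smul_smul]
  ring_nf

/-- `vec` is additive. [cite: AlbuquerqueMajid2002, §1.1] -/
theorem vec_add (v w : Fin n → K) : vec K (v + w) = vec K v + vec K w := by
  unfold vec
  rw [← Finset.sum_add_distrib]
  exact Finset.sum_congr rfl fun i _ => by rw [Pi.add_apply, add_smul]

/-- `vec` is homogeneous. [cite: AlbuquerqueMajid2002, §1.1] -/
theorem vec_smul (c : K) (v : Fin n → K) : vec K (c • v) = c • vec K v := by
  unfold vec
  rw [Finset.smul_sum]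
  exact Finset.sum_congr rfl fun i _ => by rw [Pi.smul_apply, smul_eq_mul, mul_smul]

/-- `vec` of a basis vector is the generator blade: `vec(δᵢ) = eᵢ`. [cite: AlbuquerqueMajid2002, §2 (proof of Prop. 2.2: "We identify the elements eᵢ in the two algebras")] -/
theorem vec_single (i : Fin n) : vec K (Pi.single i 1) = bladeVec K (gen i) := by
  unfold vec
  rw [Finset.sum_eq_single i]
  · simp
  · intro j _ hj
    simp [hj]
  · simp

/-- **Left multiplication** `L_a : b ↦ a · b` in `K_F[(ℤ/2)ⁿ]`, a `K`-linear endomorphism.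
[cite: AlbuquerqueMajid2002, §2] -/
def leftMul (q : Fin n → K) (a : MV n K) : MV n K →ₗ[K] MV n K where
  toFun := gp q a
  map_add' b b' := by simp only [gp_eq_twConv, twConv_add_right]
  map_smul' c b := by simp only [gp_eq_twConv, twConv_smul_right, RingHom.id_apply]

/-- `L_a b = a · b`. [cite: AlbuquerqueMajid2002, §2] -/
theorem leftMul_apply (q : Fin n → K) (a b : MV n K) : leftMul q a b = gp q a b := rfl

/-- `L_{a+a'} = L_a + L_{a'}`. [cite: AlbuquerqueMajid2002, §2] -/
theorem leftMul_add (q : Fin n → K) (a a' : MV n K) : leftMul q (a + a') = leftMul q a + leftMul q a' := by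
  apply LinearMap.ext; intro b
  simp only [LinearMap.add_apply, leftMul_apply, gp_eq_twConv, twConv_add_left]

/-- `L_{c a} = c L_a`. [cite: AlbuquerqueMajid2002, §2] -/
theorem leftMul_smul (q : Fin n → K) (c : K) (a : MV n K) : leftMul q (c • a) = c • leftMul q a := by
  apply LinearMap.ext; intro b
  simp only [LinearMap.smul_apply, leftMul_apply, gp_smul_left]

/-- The linear map `v ↦ L_v` from `V = Kⁿ` into the endomorphisms of `K_F[(ℤ/2)ⁿ]`.
[cite: AlbuquerqueMajid2002, §1.1 and §2] -/
def vecMul (q : Fin n → K) : (Fin n → K) →ₗ[K] Module.End K (MV n K) where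
  toFun v := leftMul q (vec K v)
  map_add' v w := by simp only [vec_add, leftMul_add]
  map_smul' c v := by simp only [vec_smul, leftMul_smul, RingHom.id_apply]

/-- `vecMul q v = L_{vec v}`. [cite: AlbuquerqueMajid2002, §2] -/
theorem vecMul_apply (q : Fin n → K) (v : Fin n → K) : vecMul q v = leftMul q (vec K v) := rfl

/-- **The Clifford condition** for the universal property: `L_v ∘ L_v = q(v) · id` with `q` the
diagonal quadratic form `Σᵢ qᵢ vᵢ²` (Mathlib's `QuadraticMap.weightedSumSquares K q`).
[cite: AlbuquerqueMajid2002, §1.1 (`C(V,q)` generated by `V` with `v² = q(v)`) and Prop. 2.2] -/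
theorem vecMul_mul_self (q : Fin n → K) (v : Fin n → K) :
    vecMul q v * vecMul q v =
      algebraMap K (Module.End K (MV n K)) (QuadraticMap.weightedSumSquares K q v) := by
  apply LinearMap.ext; intro b
  rw [Module.End.mul_apply, Module.algebraMap_end_apply, QuadraticMap.weightedSumSquares_apply,
    vecMul_apply, leftMul_apply, leftMul_apply, ← gp_assoc, gp_vec_vec, gp_smul_left, gp_one_left]
  simp only [smul_eq_mul]

/-- **Albuquerque–Majid Prop. 2.2, universal map.** By the universal property of the Clifford
algebra `C(V, q)` (Mathlib's `CliffordAlgebra` of the diagonal form `Σᵢ qᵢ vᵢ²` on `V = Kⁿ`), the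
assignment `v ↦ L_v` extends to a `K`-algebra homomorphism
`ρ : C(V, q) → End_K(K_F[(ℤ/2)ⁿ])` — the left-regular action of `C(V,q)` on the twisted group
algebra through the identification `eᵢ ↦ eᵢ`. [cite: AlbuquerqueMajid2002, Prop. 2.2] -/
def cliffordRep (q : Fin n → K) :
    CliffordAlgebra (QuadraticMap.weightedSumSquares K q) →ₐ[K] Module.End K (MV n K) :=
  CliffordAlgebra.lift _ ⟨vecMul q, vecMul_mul_self q⟩

/-- `ρ(ι v) = L_v`. [cite: AlbuquerqueMajid2002, Prop. 2.2] -/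
theorem cliffordRep_ι (q : Fin n → K) (v : Fin n → K) :
    cliffordRep q (CliffordAlgebra.ι _ v) = leftMul q (vec K v) :=
  CliffordAlgebra.lift_ι_apply _ _ v

/-- **The identification map** `φ : C(V, q) → K_F[(ℤ/2)ⁿ]`, `c ↦ ρ(c) e_∅` ("We identify the
elements `eᵢ` in the two algebras … hence also the basis elements `e₁^{x₁}·⋯·eₙ^{xₙ} = e_x`").
[cite: AlbuquerqueMajid2002, Prop. 2.2] -/
def toTwisted (q : Fin n → K) :
    CliffordAlgebra (QuadraticMap.weightedSumSquares K q) →ₗ[K] MV n K :=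
  (LinearMap.applyₗ (bladeVec K 0)).comp (cliffordRep q).toLinearMap

/-- `φ(c) = ρ(c) e_∅`. [cite: AlbuquerqueMajid2002, Prop. 2.2] -/
theorem toTwisted_apply (q : Fin n → K) (c : CliffordAlgebra (QuadraticMap.weightedSumSquares K q)) :
    toTwisted q c = cliffordRep q c (bladeVec K 0) := rfl

/-- `φ(ι v) = Σᵢ vᵢ eᵢ`. [cite: AlbuquerqueMajid2002, Prop. 2.2] -/
theorem toTwisted_ι (q : Fin n → K) (v : Fin n → K) :
    toTwisted q (CliffordAlgebra.ι _ v) = vec K v := by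
  rw [toTwisted_apply, cliffordRep_ι, leftMul_apply, gp_one_right]

/-- `φ(eᵢ) = eᵢ` — the generators of the two algebras are identified. [cite: AlbuquerqueMajid2002, Prop. 2.2] -/
theorem toTwisted_ι_single (q : Fin n → K) (i : Fin n) :
    toTwisted q (CliffordAlgebra.ι _ (Pi.single i 1)) = bladeVec K (gen i) := by
  rw [toTwisted_ι, vec_single]

/-- `φ(1) = e_∅`. [cite: AlbuquerqueMajid2002, Prop. 2.2] -/
theorem toTwisted_one (q : Fin n → K) : toTwisted q 1 = bladeVec K 0 := by
  rw [toTwisted_apply, map_one, Module.End.one_apply]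

/-- The representation is the left-regular action through `φ`: `ρ(c) = L_{φ(c)}` for every
`c ∈ C(V, q)` (induction over the Clifford algebra, using associativity of the twisted product).
[cite: AlbuquerqueMajid2002, Prop. 2.2 ("it remains only to check that the products coincide … inductively from the generators")] -/
theorem cliffordRep_eq_leftMul (q : Fin n → K) (c : CliffordAlgebra (QuadraticMap.weightedSumSquares K q)) :
    cliffordRep q c = leftMul q (toTwisted q c) := by
  induction c using CliffordAlgebra.induction with
  | algebraMap r =>
      apply LinearMap.ext; intro b
      rw [toTwisted_apply, AlgHom.commutes, Module.algebraMap_end_apply, Module.algebraMap_end_apply,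
        leftMul_apply, gp_smul_left, gp_one_left]
  | ι v => rw [cliffordRep_ι, toTwisted_ι]
  | mul a b ha hb =>
      have h1 : cliffordRep q (a * b) = cliffordRep q a * cliffordRep q b := map_mul _ a b
      have h2 : toTwisted q (a * b) = gp q (toTwisted q a) (toTwisted q b) := by
        rw [toTwisted_apply, h1, Module.End.mul_apply, ← toTwisted_apply q b, ha, leftMul_apply]
      rw [h1, h2, ha, hb]
      apply LinearMap.ext; intro c
      rw [Module.End.mul_apply, leftMul_apply, leftMul_apply, leftMul_apply, gp_assoc]
  | add a b ha hb =>
      rw [map_add, map_add, ha, hb, leftMul_add]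

/-- **Albuquerque–Majid Prop. 2.2 (multiplicativity): `φ(xy) = φ(x) · φ(y)`** — the product of
`C(V, q)` goes to the twisted product of `K_F[(ℤ/2)ⁿ]`; with `φ(1) = e_∅` and `φ(eᵢ) = eᵢ`, `φ` is a
unital algebra homomorphism onto the subalgebra generated by the `eᵢ`.
-- TODO(general form): bijectivity of `φ` (dimension count `2ⁿ` on both sides), i.e. the
-- isomorphism `C(V, q) ≅ K_F[(ℤ/2)ⁿ]` as printed, is not formalised here.
[cite: AlbuquerqueMajid2002, Prop. 2.2] -/
theorem toTwisted_mul (q : Fin n → K) (x y : CliffordAlgebra (QuadraticMap.weightedSumSquares K q)) :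
    toTwisted q (x * y) = gp q (toTwisted q x) (toTwisted q y) := by
  rw [toTwisted_apply, map_mul, Module.End.mul_apply, ← toTwisted_apply q y, cliffordRep_eq_leftMul,
    leftMul_apply]

/-- In particular the images of the Clifford generators obey the blade calculus:
`φ(ι eᵢ · ι eⱼ) = F(δᵢ, δⱼ) e_{δᵢ ⊕ δⱼ}`. [cite: AlbuquerqueMajid2002, Prop. 2.2 (`eᵢ · eⱼ = −eⱼ · eᵢ`, `eᵢ · eᵢ = qᵢ`)] -/
theorem toTwisted_ι_mul_ι (q : Fin n → K) (i j : Fin n) :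
    toTwisted q (CliffordAlgebra.ι _ (Pi.single i 1) * CliffordAlgebra.ι _ (Pi.single j 1)) =
      twist q (gen i) (gen j) • bladeVec K (gen i + gen j) := by
  rw [toTwisted_mul, toTwisted_ι_single, toTwisted_ι_single, gp_bladeVec_bladeVec]

/-- Peeling off a generator: if `xᵢ = 1` then `e_{x ⊕ δᵢ} · eᵢ = χ_ex(x ⊕ δᵢ, δᵢ) e_x` and the
sign is invertible, so `e_x = χ_ex(x ⊕ δᵢ, δᵢ) (e_{x ⊕ δᵢ} · eᵢ)`. [cite: AlbuquerqueMajid2002, Prop. 2.2 (`e₁^{x₁}·e₂^{x₂}⋯eₙ^{xₙ} = e_x`, products built inductively from the generators)] -/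
theorem bladeVec_eq_smul_gp (q : Fin n → K) (x : Blade n) {i : Fin n} (hi : x i = true) :
    bladeVec K x = exchSign K (x + gen i) (gen i) • gp q (bladeVec K (x + gen i)) (bladeVec K (gen i)) := by
  have hx : x + gen i + gen i = x := by rw [add_assoc, blade_add_self, add_zero]
  have hmet : metricFactor q (x + gen i) (gen i) = 1 := by
    unfold metricFactor
    refine Finset.prod_eq_one fun j _ => ?_
    by_cases hj : j = i
    · subst hj; simp [hi]
    · simp [gen_apply_of_ne hj]
  rw [gp_bladeVec_bladeVec, hx, twist, hmet, mul_one, smul_smul, exchSign_mul_self, one_smul]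

/-- **Every basis blade `e_x` is in the image of `φ`** (so `φ` maps onto the span of the blades,
i.e. onto `K_F[(ℤ/2)ⁿ]`): induction on the number of generators in `x`, peeling one generator at a
time. [cite: AlbuquerqueMajid2002, Prop. 2.2 ("Hence we can identify also the basis elements e₁^{x₁}·e₂^{x₂}⋯eₙ^{xₙ} = e_x of the two algebras")] -/
theorem bladeVec_mem_range_toTwisted (q : Fin n → K) (x : Blade n) :
    bladeVec K x ∈ LinearMap.range (toTwisted q) := by
  suffices h : ∀ (m : ℕ) (x : Blade n), (univ.filter fun i => x i = true).card = m →
      bladeVec K x ∈ LinearMap.range (toTwisted q) from h _ x rfl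
  intro m
  induction m with
  | zero =>
      intro x hx
      have hx0 : x = 0 := by
        funext i
        have : i ∉ univ.filter fun i => x i = true := by
          rw [Finset.card_eq_zero] at hx; rw [hx]; exact Finset.notMem_empty i
        simpa using this
      subst hx0
      exact ⟨1, toTwisted_one q⟩
  | succ m ih =>
      intro x hx
      obtain ⟨i, hi⟩ : ∃ i, i ∈ univ.filter fun i => x i = true := by
        apply Finset.Nonempty.exists_mem
        rw [← Finset.card_pos, hx]; exact Nat.succ_pos m
      have hxi : x i = true := by simpa using hi
      -- the peeled index `x ⊕ δᵢ` has one generator fewer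
      have hcard : (univ.filter fun j => (x + gen i) j = true).card = m := by
        have hset : (univ.filter fun j => (x + gen i) j = true) =
            (univ.filter fun j => x j = true).erase i := by
          ext j
          by_cases hj : j = i
          · subst hj; simp [hxi]
          · simp [gen_apply_of_ne hj, hj]
        rw [hset, Finset.card_erase_of_mem hi, hx]; rfl
      obtain ⟨c, hc⟩ := ih (x + gen i) hcard
      refine ⟨exchSign K (x + gen i) (gen i) • (c * CliffordAlgebra.ι _ (Pi.single i 1)), ?_⟩
      rw [map_smul, toTwisted_mul, hc, toTwisted_ι_single, ← bladeVec_eq_smul_gp q x hxi]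

/-- **`φ` is surjective**: the identification map `C(V, q) → K_F[(ℤ/2)ⁿ]` is onto (the blades
`e_x` span the coefficient space). Injectivity (equivalently `dim C(V,q) ≤ 2ⁿ`) is the part of the
printed isomorphism not formalised here. [cite: AlbuquerqueMajid2002, Prop. 2.2] -/
theorem toTwisted_surjective (q : Fin n → K) : Function.Surjective (toTwisted q) := by
  rw [← LinearMap.range_eq_top, eq_top_iff]
  rintro a -
  have ha : a = ∑ x : Blade n, a x • bladeVec K x := by
    funext z
    simp only [Finset.sum_apply, Pi.smul_apply, bladeVec, smul_eq_mul, mul_ite, mul_one, mul_zero,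
      Finset.sum_ite_eq, Finset.mem_univ, if_true]
  rw [ha]
  exact Submodule.sum_mem _ fun x _ => Submodule.smul_mem _ _ (bladeVec_mem_range_toTwisted q x)

/-! #### Injectivity in characteristic `≠ 2`: the isomorphism `C(V, q) ≅ K_F[(ℤ/2)ⁿ]` -/

section CharNeTwo

variable {L : Type*} [Field L] [Invertible (2 : L)]

/-- `dim_L C(V, q) = 2ⁿ` ("The dimension of `C(V, q)` is `2ⁿ` and it has a canonical basis
`{e_{i₁}⋯e_{i_p} | 1 ≤ i₁ < ⋯ < i_p ≤ n}`"), here from Mathlib's linear equivalence with the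
exterior algebra (characteristic `≠ 2`) and its `Finset`-indexed basis. [cite: AlbuquerqueMajid2002, §1.1] -/
theorem finrank_cliffordAlgebra (q : Fin n → L) :
    Module.finrank L (CliffordAlgebra (QuadraticMap.weightedSumSquares L q)) = 2 ^ n := by
  rw [LinearEquiv.finrank_eq (CliffordAlgebra.equivExterior _),
    Module.finrank_eq_card_basis (Module.Basis.ExteriorAlgebra (Pi.basisFun L (Fin n))),
    Fintype.card_finset, Fintype.card_fin]

omit [Invertible (2 : L)] in
/-- `dim_L K_F[(ℤ/2)ⁿ] = 2ⁿ` (one coefficient per blade). [cite: AlbuquerqueMajid2002, §2 (basis labelled by `G = ℤ₂ⁿ`); Muchane2026, §2 p. 3 (`N = 2ⁿ` coefficients)] -/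
theorem finrank_MV (n : ℕ) : Module.finrank L (MV n L) = 2 ^ n :=
  (Module.finrank_fintype_fun_eq_card (R := L) (η := Blade n)).trans (card_blade n)

/-- **Albuquerque–Majid Prop. 2.2 (isomorphism, char `≠ 2`).** Over a field in which `2` is
invertible (the source's standing hypothesis "characteristic not 2"), the identification map
`φ : C(V, q) → L_F[(ℤ/2)ⁿ]` is a bijection — with `toTwisted_mul`, `toTwisted_one` and
`toTwisted_ι_single` this is the printed statement "the algebra `k_F ℤ₂ⁿ` can be identified with
`C(V, q)`". [cite: AlbuquerqueMajid2002, Prop. 2.2] -/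
theorem toTwisted_bijective (q : Fin n → L) : Function.Bijective (toTwisted q) := by
  haveI : FiniteDimensional L (ExteriorAlgebra L (Fin n → L)) :=
    Module.Finite.of_basis (Module.Basis.ExteriorAlgebra (Pi.basisFun L (Fin n)))
  haveI : FiniteDimensional L (CliffordAlgebra (QuadraticMap.weightedSumSquares L q)) :=
    LinearEquiv.finiteDimensional (CliffordAlgebra.equivExterior _).symm
  refine ⟨?_, toTwisted_surjective q⟩
  exact (LinearMap.injective_iff_surjective_of_finrank_eq_finrank
    (by rw [finrank_cliffordAlgebra, finrank_MV])).mpr (toTwisted_surjective q)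

/-- The identification as a linear equivalence `C(V, q) ≃ₗ L_F[(ℤ/2)ⁿ]` (char `≠ 2`), multiplicative
for the twisted product by `toTwisted_mul`. [cite: AlbuquerqueMajid2002, Prop. 2.2] -/
def toTwistedEquiv (q : Fin n → L) :
    CliffordAlgebra (QuadraticMap.weightedSumSquares L q) ≃ₗ[L] MV n L :=
  LinearEquiv.ofBijective (toTwisted q) (toTwisted_bijective q)

/-- `toTwistedEquiv` is `toTwisted`. [cite: AlbuquerqueMajid2002, Prop. 2.2] -/
theorem toTwistedEquiv_apply (q : Fin n → L) (c : CliffordAlgebra (QuadraticMap.weightedSumSquares L q)) :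
    toTwistedEquiv q c = toTwisted q c := rfl

/-- Transport of the product: `φ⁻¹(a) φ⁻¹(b) = φ⁻¹(a · b)` — the Clifford product IS the
cocycle-twisted convolution under the identification. [cite: AlbuquerqueMajid2002, Prop. 2.2; Muchane2026, p. 6 (`Cℓ_{p,q}(K) ≅ K^χ[(ℤ₂)ⁿ]`)] -/
theorem toTwistedEquiv_symm_mul (q : Fin n → L) (a b : MV n L) :
    (toTwistedEquiv q).symm a * (toTwistedEquiv q).symm b = (toTwistedEquiv q).symm (gp q a b) := by
  apply (toTwistedEquiv q).injective
  change toTwisted q (_ * _) = _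
  rw [toTwisted_mul]
  change gp q (toTwistedEquiv q ((toTwistedEquiv q).symm a)) (toTwistedEquiv q ((toTwistedEquiv q).symm b)) =
    toTwistedEquiv q ((toTwistedEquiv q).symm (gp q a b))
  simp only [LinearEquiv.apply_symm_apply]

end CharNeTwo

end Literature.Computability.QuantumAlgorithms.CliffordTwistedConvolution
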